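import Summits.ValiantsHypothesis.ValiantsHypothesis.Theorems.NewtonFramesTwoProductsFrameRungTwoRainbowBlocks

/-!
# Crux `TwoProducts` (stmt-5906), line `FrameRungTwo`: the block theorem of (IX) for WEIGHTED block systems — the lightest
element is monochromatic, hence `J ∖ {j₀}` and `{j₀}` are blocks of one colour

Sequel to `…FrameRungTwoRainbowBlocks.lean` (engine `erase_mem_of_mono`: unique rainbow partitions + a monochromatic element ⇒
complementary block pair).  In the block abstraction of the shallow-neighbour lemma (IX) (memo `Cruxes/TwoProducts/memo-IX-blocks.md`)
the demoted coordinates carry weights `w j = l(T j − a j) ≥ 0`, and "every cancelled point of the other frame key-above the vertex is a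
word of the member frame" gives, for a member frame without light additive coincidences, the OVERLAP INEQUALITY
(L2) two blocks of different colours that meet satisfy `Σ_{J ∖ (F ∪ F′)} w < Σ_{F ∩ F′} w`.
This file closes the abstract theorem:

* `mono_of_lightest` — under (L2) an element of minimal weight is monochromatic (a block `F ∋ j₀` of another colour meets the block
  `{j₀}`, and the outside `J ∖ F` contains an element at least as heavy as `j₀`);
* `complementary_pair_of_lightest` — (A1) + (A2) + (L2) ⇒ `{j₀}` and `J ∖ {j₀}` are blocks of the same colour: the vertex is the common
  top minus two letter gaps of ONE coordinate of the non-member frame, and un-demoting the lightest letter of the vertex word gives a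
  common neighbour of non-member depth `1` (the strong form of (IX) for generic member frames; verified exhaustively for `|J| ≤ 5`,
  exp/blocks.py of the memo).
Honest scope: finite combinatorics for ONE stub of a rung strictly below the crux `TwoProducts`; nothing here bears on `VP ≠ VNP`.
[ours]
-/

set_option linter.dupNamespace false

namespace Summit.ValiantsHypothesis.ValiantsHypothesis.Theorems.NewtonFramesTwoProducts.FrameRungTwoBlocks

open Finset

variable {α ι : Type*} [DecidableEq α]

section Lightest

/-- **Geometry of the lightest letter.**  With nonnegative weights, if every two blocks of different colours that meet satisfy the
overlap inequality (L2), then every block through an element `j₀` of minimal weight (among the proper subsets of `J`, with `{j₀}` a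
block) has the colour of `{j₀}`. [ours] -/
theorem mono_of_lightest {J : Finset α} {B : Finset (Finset α)} {κ : Finset α → ι} {w : α → ℝ} {j₀ : α}
    (hw : ∀ j ∈ J, 0 ≤ w j) (hj₀ : j₀ ∈ J) (hmin : ∀ j ∈ J, w j₀ ≤ w j) (hj₀B : {j₀} ∈ B)
    (hL2 : ∀ F ∈ B, ∀ F' ∈ B, F ⊂ J → F' ⊂ J → κ F ≠ κ F' → (F ∩ F').Nonempty →
      ∑ j ∈ J \ (F ∪ F'), w j < ∑ j ∈ F ∩ F', w j) :
    ∀ F ∈ B, F ⊂ J → j₀ ∈ F → κ F = κ {j₀} := by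
  intro F hF hFJ hjF
  by_contra hne
  -- an element outside `F`
  obtain ⟨k, hkJ, hkF⟩ := Finset.exists_of_ssubset hFJ
  have hj₀J : ({j₀} : Finset α) ⊂ J := by
    refine Finset.ssubset_iff_subset_ne.2 ⟨Finset.singleton_subset_iff.2 hj₀, fun h => hkF ?_⟩
    have hk : k ∈ ({j₀} : Finset α) := h ▸ hkJ
    rw [Finset.mem_singleton] at hk
    rw [hk]; exact hjF
  have hmeet : (F ∩ {j₀}).Nonempty := ⟨j₀, Finset.mem_inter.2 ⟨hjF, Finset.mem_singleton_self _⟩⟩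
  have hlt := hL2 F hF {j₀} hj₀B hFJ hj₀J hne hmeet
  have hI : F ∩ {j₀} = {j₀} := Finset.inter_eq_right.2 (Finset.singleton_subset_iff.2 hjF)
  have hU : F ∪ {j₀} = F := Finset.union_eq_left.2 (Finset.singleton_subset_iff.2 hjF)
  rw [hI, hU, Finset.sum_singleton] at hlt
  -- but the outside weighs at least `w k ≥ w j₀`
  have hk : k ∈ J \ F := Finset.mem_sdiff.2 ⟨hkJ, hkF⟩
  have hge : w k ≤ ∑ j ∈ J \ F, w j :=
    Finset.single_le_sum (fun j hj => hw j (Finset.mem_sdiff.1 hj).1) hk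
  exact absurd (hlt.trans_le ((hmin k hkJ).trans hge)) (lt_irrefl _)

/-- **The block theorem of (IX) (generic member frame), abstract form.**  In a coloured block system on `J` (`|J| ≥ 2`) with
nonnegative weights in which (A1) every proper nonempty subset has exactly one rainbow partition, (A2) `J` has none, and (L2) meeting
blocks of different colours satisfy the overlap inequality, an element `j₀` of minimal weight gives the complementary pair: `{j₀}` and
`J ∖ {j₀}` are blocks of the same colour. [ours] -/
theorem complementary_pair_of_lightest {J : Finset α} {B : Finset (Finset α)} {κ : Finset α → ι} {w : α → ℝ} {j₀ : α}
    (hJ : 2 ≤ J.card) (hw : ∀ j ∈ J, 0 ≤ w j) (hj₀ : j₀ ∈ J) (hmin : ∀ j ∈ J, w j₀ ≤ w j)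
    (hA1 : ∀ E, E ⊂ J → E.Nonempty → ∃ P : Finset (Finset α), (P ⊆ B ∧ (∀ F ∈ P, F.Nonempty) ∧
      (∀ F ∈ P, ∀ F' ∈ P, F ≠ F' → Disjoint F F') ∧ P.biUnion id = E ∧ ∀ F ∈ P, ∀ F' ∈ P, κ F = κ F' → F = F') ∧
      ∀ P' : Finset (Finset α), (P' ⊆ B ∧ (∀ F ∈ P', F.Nonempty) ∧
        (∀ F ∈ P', ∀ F' ∈ P', F ≠ F' → Disjoint F F') ∧ P'.biUnion id = E ∧ ∀ F ∈ P', ∀ F' ∈ P', κ F = κ F' → F = F') →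
        P' = P)
    (hA2 : ∀ P : Finset (Finset α), ¬ (P ⊆ B ∧ (∀ F ∈ P, F.Nonempty) ∧
      (∀ F ∈ P, ∀ F' ∈ P, F ≠ F' → Disjoint F F') ∧ P.biUnion id = J ∧ ∀ F ∈ P, ∀ F' ∈ P, κ F = κ F' → F = F'))
    (hL2 : ∀ F ∈ B, ∀ F' ∈ B, F ⊂ J → F' ⊂ J → κ F ≠ κ F' → (F ∩ F').Nonempty →
      ∑ j ∈ J \ (F ∪ F'), w j < ∑ j ∈ F ∩ F', w j) :
    {j₀} ∈ B ∧ J.erase j₀ ∈ B ∧ κ (J.erase j₀) = κ {j₀} := by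
  have hj₀B : ({j₀} : Finset α) ∈ B :=
    singleton_mem_of_rainbowBelow (fun E hE hEne => (hA1 E hE hEne).imp fun _ hP => hP.1) hJ hj₀
  exact complementary_pair_of_mono hj₀ hJ hA1 hA2 (mono_of_lightest hw hj₀ hmin hj₀B hL2)

end Lightest

end Summit.ValiantsHypothesis.ValiantsHypothesis.Theorems.NewtonFramesTwoProducts.FrameRungTwoBlocks
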